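import Summits.BirchSwinnertonDyer.BirchSwinnertonDyer.Theorems.EdixhovenFibreFiveSevenStarredOptimalManinUnitFiveSevenTransportedReciprocityTransportHom
import Literature.NumberTheory.PAdicHodge.PadicLogCurveFOChart
import Literature.NumberTheory.EllipticCurves.PadicLogFiniteExtensionLocalFieldProofs
import HarnessLib

/-!
# Kato's explicit reciprocity law for a curve `W/K₀` mapping onto a RAMIFIED good supersingular model by an equivariant HOMOMORPHISM with `T_p(φ)`
# an isomorphism — at EVERY point of `W(K_v)` (`→+` twin of `…TransportedReciprocityTransportAllPoints`; sequel of `…TransportedReciprocityTransportHom`)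

Cell `pub/bsd-wall`, D-0145 line `route-BirchSwinnertonDyer-EdixhovenFibreFiveSeven`, seat `bsd-line-edix-p4` (gen 28); crux K★
`stmt-BirchSwinnertonDyer-22226` (`StarredOptimalManinUnitFiveSeven`), line `kato_lever`, memo `Cruxes/StarredOptimalManinUnitFiveSeven/Lines/
kato-lever-seam-rec-at-cells.md` §5 (row `c′, hrec′`). THEOREMS ONLY (no definition, no named fact, no instance, no `sorry`); helper
`--supports stmt-BirchSwinnertonDyer-22226`. **BSD is not proved by this file, and neither is K★ or [REC-tower]**: it is the `φ`-twin of
`…TransportedReciprocity` / `…TransportedReciprocityAllPoints` — the SAME chain (transported period maps `exists_transported_periodHoms`, Hodge line and `hne`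
from `TransportedHodgePairHneOmega.exists_hodgePair_fil_and_hne`, T5-B along the TRANSPORT matching `BmaxPlusTransportedReciprocityTransport`, the chart
`PadicLogCurveFOChart`, the index step) for a Weierstrass curve `W` over a subfield `K₀ ⊆ F = K_v` that is ISOMORPHIC over `F` to the good `𝒪_D`-model
`E = curveFO F (W_D ⊗_ψ 𝒪_F)` (`φ` equivariant on geometric points with Tate-module map `T_p(φ)`, and for the all-points form its `F`-rational restriction `φ_F`),
so that the pairing `⟨[η], P⟩`, `exp*_d`, the line `d` and the representation are those of `W` ITSELF — for the K★ cells `K₀ = ℚ`, `W = W_min`,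
`F = ℚ_p(ζ_m)_w(ϖ)`: the hypothesis `hrec'` of `…ReciprocityTowerFromAbove.exists_const_tower_clauses_of_formula_above` up to the unit rescaling of `log_ω`
under the change of variables (`log_ω^E(φ_F P)` vs `log_ω^{W ⊗ F}(P)`), not done here.

* (previous file) `TransportedReciprocityTransport.exists_const_tatePairingPoint_eq_neg_trace_of_omegaPeriod_ne_zero_transport` — points over deep formal points, free `c_P`;
* ★★★★ `exists_const_tatePairingPoint_eq_trace_mul_padicLog_transport` — **`⟨[η], P⟩_W = Tr_{F/ℚ_p}(c · exp*_d(η) · log_ω^E(φ_F P))` for EVERY `P ∈ W(F)`.**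

What a K★ cell must still supply: its instances (`W_D`, `E₀`, `p ∈ {5,7}`, `map_explicitModel_eq_map_cmFibre`), the change of variables `φ` (with `T_p(φ)`,
`φ_F`) from `W_min ⊗ F` onto the model and the rescaling of `log_ω` under it (`PadicLogFiniteExtensionVariableChangeProofs`), (N1′) (tree), the Weil tower /
`ψ` / de Rham binders, and the descent / Galois averaging (`…ReciprocityTowerFromAbove`); K★ needs in addition P1-bar (print) and REC at the ordinary cells.

References: [cite: Kato1993LNM1553, Ch. II Thm. 1.4.1 (3)–(4), Lemma 1.4.3] · [cite: BlochKato1990, Ex. 3.10.1, Example 3.11] ·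
[cite: Colmez1992PeriodesAbeliennes, §2] · [cite: Katz1981CrystallineDieudonne, Thm. 5.1.4–5.1.5] · [cite: SilvermanAEC2009, Thm. IV.6.4, Prop. VII.2.2, VIII §2, X §4].
-/

set_option autoImplicit false
-- single-conjunct summit: `Summit.BirchSwinnertonDyer.BirchSwinnertonDyer.…` repeats the name by design
set_option linter.dupNamespace false

noncomputable section

open Field Function ValuativeRel WittVector NumberField IsDedekindDomain
open scoped NumberField Topology Classical NNReal
open Literature.NumberTheory.PAdicHodge Literature.NumberTheory.GaloisRepresentations
  Literature.NumberTheory.GaloisRepresentations.IsNonarchimedeanLocalField Literature.NumberTheory.GaloisRepresentations.LubinTate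
  Literature.NumberTheory.GaloisCohomology Literature.NumberTheory.EllipticCurves Literature.NumberTheory.EllipticCurves.FormalGroupChart
  Literature.NumberTheory.PAdicHodge.GaloisContinuity Literature.IUT.LogVolume Literature.RingTheory.FormalGroups
  Literature.AlgebraicGeometry.Resolution _root_.WeierstrassCurve

namespace Summit.BirchSwinnertonDyer.BirchSwinnertonDyer.Theorems.TransportedReciprocityTransportHomAllPoints

variable {K : Type} [Field K] [NumberField K] {p : ℕ} [hprime : Fact p.Prime] (v : HeightOneSpectrum (𝓞 K))
  [CharZero (v.adicCompletion K)] [LocallyCompactSpace (absoluteGaloisGroup (v.adicCompletion K))]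
  [Fact (¬ IsUnit (p : integerC (v.adicCompletion K)))]
  [IsAdicComplete (Ideal.span {(p : integerC (v.adicCompletion K))}) (integerC (v.adicCompletion K))]
  [CharP 𝓀[v.adicCompletion K] p] [CharZero (CompletedAlgClosure (v.adicCompletion K))]
  (hpv : valuation (v.adicCompletion K) (p : v.adicCompletion K) < 1)
  (Dv : EisensteinRoot (v.adicCompletion K) p hpv) (Wm : WeierstrassCurve (EisensteinRoot.CoeffDisc Dv))
  (ψm : EisensteinRoot.CoeffDisc Dv →+* LTCoeff (v.adicCompletion K))
  (hψm : ∀ c, algebraMap (LTCoeff (v.adicCompletion K)) (v.adicCompletion K) (ψm c) = EisensteinRoot.CoeffDisc.toF Dv c)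
  (hp2 : p ≠ 2) (hΔ : IsUnit (Wm.map ψm).Δ) (hA : ((Wm.map ψm).map (AinfTop.redCoeff (v.adicCompletion K))).hasseCoeff p = 0)
  [(AinfTop.curveFO (v.adicCompletion K) (Wm.map ψm)).IsElliptic]
  [(curveOver (CompletedAlgClosure (v.adicCompletion K)) (Wm.map ψm)).IsElliptic]
  -- the curve `W/K₀`, the isomorphism of geometric points onto the good model, and its Tate-module map
  {K₀ : Type} [Field K₀] [CharZero K₀] (W : WeierstrassCurve K₀) [W.IsElliptic] [Algebra K₀ (v.adicCompletion K)]
  (φ : geomPoints (W.baseChange (v.adicCompletion K)) →+ (AinfTop.curveFO (v.adicCompletion K) (Wm.map ψm)).geomPoints)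
  (hφ : ∀ (σ : absoluteGaloisGroup (v.adicCompletion K)) (P : geomPoints (W.baseChange (v.adicCompletion K))), φ (σ • P) = σ • φ P)
  (Tφ : (W.baseChange (v.adicCompletion K)).tateModule p ≃ₗ[ℤ_[p]] (AinfTop.curveFO (v.adicCompletion K) (Wm.map ψm)).tateModule p)
  (hTφ : ∀ (a : (W.baseChange (v.adicCompletion K)).tateModule p) (n : ℕ), TateModule.proj p n (Tφ a) = φ (TateModule.proj p n a))
  -- the Weil tower of `W`
  (e : (k : ℕ) → geomTorsion W ((p ^ k : ℕ) : ℤ) → geomTorsion W ((p ^ k : ℕ) : ℤ) → AlgebraicClosure K₀)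
  (hμ : ∀ k S T, e k S T ^ (p ^ k) = 1) (hadd₁ : ∀ k S₁ S₂ T, e k (S₁ + S₂) T = e k S₁ T * e k S₂ T)
  (hadd₂ : ∀ k S T₁ T₂, e k S (T₁ + T₂) = e k S T₁ * e k S T₂)
  (hgal : ∀ k (σ : absoluteGaloisGroup K₀) (S T : geomTorsion W ((p ^ k : ℕ) : ℤ)), σ • e k S T = e k (σ • S) (σ • T))
  (hcompat : ∀ k (S T : geomTorsion W ((p ^ (k + 1) : ℕ) : ℤ)),
    e k (torsionMulHom W (p ^ (k + 1)) (p ^ k) p (pow_succ p k).symm S)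
      (torsionMulHom W (p ^ (k + 1)) (p ^ k) p (pow_succ p k).symm T) = e (k + 1) S T ^ p)

include hgal hp2 hΔ hA hψm hφ hTφ in
/-- ★★★★ **Kato's explicit reciprocity law at EVERY point of `W(F)`, for `W/K₀` isomorphic over `F = K_v` to a ramified good supersingular model, in the
currency `⟨[η], P⟩_W = Tr_{F/ℚ_p}(c · exp*_d(η) · log_ω^E(φ_F P))`.** Same inputs as `exists_const_tatePairingPoint_eq_neg_trace_of_omegaPeriod_ne_zero_transport`,
plus a compatible valuation `w` of `F` and the `F`-rational map `φ_F : W(F) → E(F)` under `φ` (`hφF : φ(ι P) = ι(φ_F P)`; e.g. an admissible change of variables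
over `F`). Then ONE `c ∈ F` gives, for every cocycle `η` of `T_pW|_{Γ_F}` and EVERY `P ∈ W(F)`: **`⟨[η], P⟩_W = Tr_{F/ℚ_p}(c · exp*_d(η) · log_ω(φ_F P))`**,
`log_ω = padicLogPointFiniteExt w E p` of the MODEL (a change of variables rescales it by its unit `u`, absorbed in `c` by the caller) — the shape of `hrec'` of
`…ReciprocityTowerFromAbove.exists_const_tower_clauses_of_formula_above`. Proof: the previous theorem ON the set `{Q : φ_F Q ∈ E⁽ᵖ⁾(F)}` with `c_Q := p^N·log_ω(φ_F Q)`
(division sequence `LocalTatePairingKummerTadic.exists_divSeq`, the dictionary `AinfTop.geomToCO_toGeomPoints_mem_kernel` /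
`AinfTop.norm_zCoord_geomToCO_toGeomPoints_pow_le` and THE CHART `AinfTop.algebraMap_pow_mul_padicLogPointFiniteExt_curveFO_eq` at `φ_F Q`), then OFF it:
every `φ_F P` has a positive multiple in the level (`exists_nsmul_mem_level_of_isNonarchimedeanLocalField`), `⟨[η], ·⟩`, `φ_F` are additive and
`log_ω(m • R) = m · log_ω(R)` (`padicLogPointFiniteExt_nsmul_of_isNonarchimedeanLocalField`), `char ℚ_p = 0`.
[cite: Kato1993LNM1553, Ch. II Thm. 1.4.1 (3)–(4), Lemma 1.4.3] [cite: BlochKato1990, Ex. 3.10.1, Example 3.11] [cite: SilvermanAEC2009, Thm. IV.6.4, Prop. VII.2.1–VII.2.2, X §4] -/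
theorem exists_const_tatePairingPoint_eq_trace_mul_padicLog_transportHom (hp5 : 5 ≤ p)
    (E₀ : WeierstrassCurve ℤ)
    (hWE : Wm.map (Ideal.Quotient.mk (Ideal.span {EisensteinRoot.CoeffDisc.of Dv (AdjoinRoot.root Dv.poly)})) =
      (E₀.map (algebraMap ℤ (EisensteinRoot.CoeffDisc Dv))).map
        (Ideal.Quotient.mk (Ideal.span {EisensteinRoot.CoeffDisc.of Dv (AdjoinRoot.root Dv.poly)})))
    (hΔ₀ : ¬ (p : ℤ) ∣ E₀.Δ) (hA₀ : (E₀.map (Int.castRingHom (ZMod p))).hasseCoeff p = 0)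
    [(E₀.map (Int.castRingHom ℚ_[p])).IsElliptic] [(E₀.map (Int.castRingHom (ZMod p))).IsElliptic]
    [(curveOver (CompletedAlgClosure (v.adicCompletion K)) E₀).IsElliptic]
    {N : ℕ} (hN : Dv.e ≤ N)
    (hN1' : ∃ τ : AinfTop.TatePtO (v.adicCompletion K) (Wm.map ψm) p,
      AinfRamTop.omegaPeriod Wm (surjective_fontaineTheta_integerC hpv) (AinfTop.seqO (Wm.map ψm) τ) (AinfTop.seqO_zero (Wm.map ψm) τ)
        (AinfRamTop.mulPC_seqO Wm ψm hψm τ) ≠ 0)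
    (ψ : C(absoluteGaloisGroup (v.adicCompletion K), ℤ_[p])) (hψ : ∀ σ τ, ψ (σ * τ) = ψ σ + ψ τ)
    (hψlog : ∀ τ, (ψ τ : ℚ_[p]) = logCyclotomic (F := (v.adicCompletion K)) p τ)
    (heL : ∀ (c : ℤ_[p]) (S U : W.tateModule p),
      (weilContPairingPadic W (v.adicCompletion K) p e hμ hadd₁ hadd₂ hgal hcompat).toLin (c • S) U =
      twistHom (v.adicCompletion K) p ((weilContPairingPadic W (v.adicCompletion K) p e hμ hadd₁ hadd₂ hgal hcompat).toLin S U) c)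
    (healt : ∀ S : W.tateModule p,
      (weilContPairingPadic W (v.adicCompletion K) p e hμ hadd₁ hadd₂ hgal hcompat).toLin S S = 0)
    (henondeg : ∀ S : W.tateModule p,
      (∀ U, (weilContPairingPadic W (v.adicCompletion K) p e hμ hadd₁ hadd₂ hgal hcompat).toLin S U = 0) → S = 0)
    (hinj : letI := LocalField.padicAlgebra (v.adicCompletion K) p hpv
      (bdRPeriodRingData (F := (v.adicCompletion K)) (p := p) hpv).CupLogInjective (logCyclotomic p)
        (restrictedRationalTateRep W (v.adicCompletion K) p))
    (hde : letI := LocalField.padicAlgebra (v.adicCompletion K) p hpv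
      ∀ η : contOneCocycles (restrictedTateRep W (v.adicCompletion K) p).toTopRep,
        (bdRPeriodRingData (F := (v.adicCompletion K)) (p := p) hpv).HasDualExp (logCyclotomic p)
          (restrictedRationalTateRep W (v.adicCompletion K) p)
          fun σ => TateModule.toRational p (η.1 σ))
    (d : letI := LocalField.padicAlgebra (v.adicCompletion K) p hpv
      (bdRPeriodRingData (F := (v.adicCompletion K)) (p := p) hpv).FilZeroLine
        (restrictedRationalTateRep W (v.adicCompletion K) p))
    -- the valuation for `log_ω` and the `F`-rational isomorphism under `φ`
    (w : Valuation (v.adicCompletion K) ℝ≥0) [w.Compatible] [(AinfTop.curveFO (v.adicCompletion K) (Wm.map ψm)).IsIntegral w.integer] :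
    ∀ (φF : (W.baseChange (v.adicCompletion K)).toAffine.Point →+ (AinfTop.curveFO (v.adicCompletion K) (Wm.map ψm)).toAffine.Point)
      (_ : ∀ P, φ (toGeomPoints (W.baseChange (v.adicCompletion K)) P) = toGeomPoints (AinfTop.curveFO (v.adicCompletion K) (Wm.map ψm)) (φF P)),
    letI := LocalField.padicAlgebra (v.adicCompletion K) p hpv
    ∃ c : v.adicCompletion K,
      ∀ (η : contOneCocycles (restrictedTateRep W (v.adicCompletion K) p).toTopRep) (P : (W.baseChange (v.adicCompletion K)).toAffine.Point),
        ((tatePairingPoint W (v.adicCompletion K) p e hμ hadd₁ hadd₂ hgal hcompat (oneCocycleClass _ η) P : ℤ_[p]) : ℚ_[p]) =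
          Algebra.trace ℚ_[p] (v.adicCompletion K)
            (c * expStarCoord W hpv d η *
              padicLogPointFiniteExt w (AinfTop.curveFO (v.adicCompletion K) (Wm.map ψm)) p (φF P)) := by
  intro φF hφF
  letI := LocalField.padicAlgebra (v.adicCompletion K) p hpv
  -- the previous theorem (STEPWISE application)
  have h1 := TransportedReciprocityTransportHom.exists_const_tatePairingPoint_eq_neg_trace_of_omegaPeriod_ne_zero_transportHom v hpv Dv Wm ψm hψm hp2
    hΔ hA W φ hφ Tφ hTφ e hμ hadd₁ hadd₂ hgal hcompat hp5 E₀ hWE hΔ₀ hA₀ (N := N) hN hN1' ψ hψ hψlog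
  have h2 := h1 heL healt henondeg
  obtain ⟨c₀, hc₀⟩ := h2 hinj hde d
  clear h1 h2
  refine ⟨-((p : v.adicCompletion K) ^ N * c₀), fun η P => ?_⟩
  have hp0 : (p : v.adicCompletion K) ≠ 0 := Nat.cast_ne_zero.2 hprime.out.ne_zero
  have hN0 : N ≠ 0 := (Nat.lt_of_lt_of_le Dv.e_pos hN).ne'
  -- the formula at every `Q ∈ W(F)` with `φ_F Q` in the level of the model, `c_Q := p^N · log_ω(φ_F Q)`
  have hlevel : ∀ Q : (W.baseChange (v.adicCompletion K)).toAffine.Point,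
      φF Q ∈ level w (AinfTop.curveFO (v.adicCompletion K) (Wm.map ψm)) (w (p : v.adicCompletion K)) →
      ((tatePairingPoint W (v.adicCompletion K) p e hμ hadd₁ hadd₂ hgal hcompat (oneCocycleClass _ η) Q : ℤ_[p]) : ℚ_[p]) =
        -Algebra.trace ℚ_[p] (v.adicCompletion K)
          ((p : v.adicCompletion K) ^ N * padicLogPointFiniteExt w (AinfTop.curveFO (v.adicCompletion K) (Wm.map ψm)) p (φF Q) *
            (expStarCoord W hpv d η * c₀)) := by
    intro Q hQ
    obtain ⟨Qs, hQs0, hQs⟩ := exists_divSeq W (v.adicCompletion K) p Q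
    have hφQ0 : (⇑φ ∘ Qs) 0 = toGeomPoints (AinfTop.curveFO (v.adicCompletion K) (Wm.map ψm)) (φF Q) := by
      change φ (Qs 0) = _
      rw [hQs0, hφF]
    have hker : AinfTop.geomToCO (Wm.map ψm) ((⇑φ ∘ Qs) 0) ∈ kernel (NormedField.valuation (K := CompletedAlgClosure (v.adicCompletion K)))
        (curveOver (CompletedAlgClosure (v.adicCompletion K)) (Wm.map ψm)) := by
      rw [hφQ0]; exact AinfTop.geomToCO_toGeomPoints_mem_kernel _ w hQ.1
    have hz : ((zPt (AinfTop.geomToCO (Wm.map ψm) ((⇑φ ∘ Qs) 0)) hker : CBall (v.adicCompletion K)) : CompletedAlgClosure (v.adicCompletion K)) =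
        (AinfTop.geomToCO (Wm.map ψm) (toGeomPoints (AinfTop.curveFO (v.adicCompletion K) (Wm.map ψm)) (φF Q))).zCoord := by
      rw [coe_zPt, hφQ0]
    have hdepth : ‖((zPt (AinfTop.geomToCO (Wm.map ψm) ((⇑φ ∘ Qs) 0)) hker : CBall (v.adicCompletion K)) :
        CompletedAlgClosure (v.adicCompletion K))‖ ^ N ≤ ‖(p : CompletedAlgClosure (v.adicCompletion K))‖ := by
      rw [hz]; exact AinfTop.norm_zCoord_geomToCO_toGeomPoints_pow_le (Wm.map ψm) hpv w hQ hN0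
    have hcP : algebraMap (v.adicCompletion K) (CompletedAlgClosure (v.adicCompletion K))
        ((p : v.adicCompletion K) ^ N * padicLogPointFiniteExt w (AinfTop.curveFO (v.adicCompletion K) (Wm.map ψm)) p (φF Q)) =
        (p : CompletedAlgClosure (v.adicCompletion K)) ^ N *
          ∑' j : ℕ, PowerSeries.coeff j (Wm.map ((CBall (v.adicCompletion K)).subtype.comp (EisensteinRoot.CoeffDisc.toCBall Dv))).formalLog *
            ((zPt (AinfTop.geomToCO (Wm.map ψm) ((⇑φ ∘ Qs) 0)) hker : CBall (v.adicCompletion K)) : CompletedAlgClosure (v.adicCompletion K)) ^ j := by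
      rw [hz]; exact AinfTop.algebraMap_pow_mul_padicLogPointFiniteExt_curveFO_eq Dv Wm ψm hψm w hQ N
    exact hc₀ η Q Qs hQs hQs0 hker hdepth _ hcP
  -- off the level: a positive multiple of `φ_F P` lies in the level; `⟨[η], ·⟩`, `φ_F`, `log_ω` are additive; `char ℚ_p = 0`
  obtain ⟨m, hm, hmP⟩ := exists_nsmul_mem_level_of_isNonarchimedeanLocalField (AinfTop.curveFO (v.adicCompletion K) (Wm.map ψm)) w hp0 (φF P)
  have h := hlevel (m • P) (by rw [map_nsmul]; exact hmP)
  rw [map_nsmul φF m P, padicLogPointFiniteExt_nsmul_of_isNonarchimedeanLocalField (AinfTop.curveFO (v.adicCompletion K) (Wm.map ψm)) w hp0 hpv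
    (φF P) m, map_nsmul (tatePairingPoint W (v.adicCompletion K) p e hμ hadd₁ hadd₂ hgal hcompat (oneCocycleClass _ η)) m P, nsmul_eq_mul,
    PadicInt.coe_mul, PadicInt.coe_natCast] at h
  have htr : Algebra.trace ℚ_[p] (v.adicCompletion K) ((p : v.adicCompletion K) ^ N *
      ((m : v.adicCompletion K) * padicLogPointFiniteExt w (AinfTop.curveFO (v.adicCompletion K) (Wm.map ψm)) p (φF P)) * (expStarCoord W hpv d η * c₀)) =
      (m : ℚ_[p]) * Algebra.trace ℚ_[p] (v.adicCompletion K) ((p : v.adicCompletion K) ^ N *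
        padicLogPointFiniteExt w (AinfTop.curveFO (v.adicCompletion K) (Wm.map ψm)) p (φF P) * (expStarCoord W hpv d η * c₀)) := by
    rw [show (p : v.adicCompletion K) ^ N * ((m : v.adicCompletion K) *
        padicLogPointFiniteExt w (AinfTop.curveFO (v.adicCompletion K) (Wm.map ψm)) p (φF P)) * (expStarCoord W hpv d η * c₀) =
        m • ((p : v.adicCompletion K) ^ N * padicLogPointFiniteExt w (AinfTop.curveFO (v.adicCompletion K) (Wm.map ψm)) p (φF P) *
          (expStarCoord W hpv d η * c₀)) by rw [nsmul_eq_mul]; ring, LinearMap.map_smul_of_tower, nsmul_eq_mul]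
  rw [htr, ← mul_neg] at h
  have hm0 : (m : ℚ_[p]) ≠ 0 := by exact_mod_cast hm.ne'
  rw [mul_left_cancel₀ hm0 h, ← map_neg]
  congr 1
  ring

include hgal hp2 hΔ hA hψm hφ hTφ in
/-- ★★★ **The `hrec'` shape on the nose.** If, in addition, `log_ω^E ∘ φ_F = u · log_ω^{W ⊗ F}` for some `u ∈ F` and some valuation `w'` of `F` for which
`W ⊗ F` is integral (`hlogφ`; for `φ_F = ι_C` an admissible change of variables `C = (u, r, s, t)` this is
`FormalGroupChart.padicLogPointFiniteExt_pointMap_of_variableChange` — *AEC* III.1 Table 3.1, `u⁻¹ω' = ω`), then ONE `c ∈ F` gives for every cocycle `η` of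
`T_pW|_{Γ_F}` and EVERY `P ∈ W(F)`: **`⟨[η], P⟩_W = Tr_{F/ℚ_p}(c · exp*_d(η) · log_ω^{W ⊗ F}(P))`** — literally the hypothesis `hrec'` of
`…ReciprocityTowerFromAbove.exists_const_tower_clauses_of_formula_above` (at `K' := F`, for the line `d`).
[cite: Kato1993LNM1553, Ch. II Thm. 1.4.1 (3)–(4)] [cite: SilvermanAEC2009, III.1 Table 3.1, Thm. IV.6.4] -/
theorem exists_const_tatePairingPoint_eq_trace_mul_padicLog_transportHom_of_log_eq (hp5 : 5 ≤ p)
    (E₀ : WeierstrassCurve ℤ)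
    (hWE : Wm.map (Ideal.Quotient.mk (Ideal.span {EisensteinRoot.CoeffDisc.of Dv (AdjoinRoot.root Dv.poly)})) =
      (E₀.map (algebraMap ℤ (EisensteinRoot.CoeffDisc Dv))).map
        (Ideal.Quotient.mk (Ideal.span {EisensteinRoot.CoeffDisc.of Dv (AdjoinRoot.root Dv.poly)})))
    (hΔ₀ : ¬ (p : ℤ) ∣ E₀.Δ) (hA₀ : (E₀.map (Int.castRingHom (ZMod p))).hasseCoeff p = 0)
    [(E₀.map (Int.castRingHom ℚ_[p])).IsElliptic] [(E₀.map (Int.castRingHom (ZMod p))).IsElliptic]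
    [(curveOver (CompletedAlgClosure (v.adicCompletion K)) E₀).IsElliptic]
    {N : ℕ} (hN : Dv.e ≤ N)
    (hN1' : ∃ τ : AinfTop.TatePtO (v.adicCompletion K) (Wm.map ψm) p,
      AinfRamTop.omegaPeriod Wm (surjective_fontaineTheta_integerC hpv) (AinfTop.seqO (Wm.map ψm) τ) (AinfTop.seqO_zero (Wm.map ψm) τ)
        (AinfRamTop.mulPC_seqO Wm ψm hψm τ) ≠ 0)
    (ψ : C(absoluteGaloisGroup (v.adicCompletion K), ℤ_[p])) (hψ : ∀ σ τ, ψ (σ * τ) = ψ σ + ψ τ)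
    (hψlog : ∀ τ, (ψ τ : ℚ_[p]) = logCyclotomic (F := (v.adicCompletion K)) p τ)
    (heL : ∀ (c : ℤ_[p]) (S U : W.tateModule p),
      (weilContPairingPadic W (v.adicCompletion K) p e hμ hadd₁ hadd₂ hgal hcompat).toLin (c • S) U =
      twistHom (v.adicCompletion K) p ((weilContPairingPadic W (v.adicCompletion K) p e hμ hadd₁ hadd₂ hgal hcompat).toLin S U) c)
    (healt : ∀ S : W.tateModule p,
      (weilContPairingPadic W (v.adicCompletion K) p e hμ hadd₁ hadd₂ hgal hcompat).toLin S S = 0)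
    (henondeg : ∀ S : W.tateModule p,
      (∀ U, (weilContPairingPadic W (v.adicCompletion K) p e hμ hadd₁ hadd₂ hgal hcompat).toLin S U = 0) → S = 0)
    (hinj : letI := LocalField.padicAlgebra (v.adicCompletion K) p hpv
      (bdRPeriodRingData (F := (v.adicCompletion K)) (p := p) hpv).CupLogInjective (logCyclotomic p)
        (restrictedRationalTateRep W (v.adicCompletion K) p))
    (hde : letI := LocalField.padicAlgebra (v.adicCompletion K) p hpv
      ∀ η : contOneCocycles (restrictedTateRep W (v.adicCompletion K) p).toTopRep,
        (bdRPeriodRingData (F := (v.adicCompletion K)) (p := p) hpv).HasDualExp (logCyclotomic p)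
          (restrictedRationalTateRep W (v.adicCompletion K) p)
          fun σ => TateModule.toRational p (η.1 σ))
    (d : letI := LocalField.padicAlgebra (v.adicCompletion K) p hpv
      (bdRPeriodRingData (F := (v.adicCompletion K)) (p := p) hpv).FilZeroLine
        (restrictedRationalTateRep W (v.adicCompletion K) p))
    (w : Valuation (v.adicCompletion K) ℝ≥0) [w.Compatible] [(AinfTop.curveFO (v.adicCompletion K) (Wm.map ψm)).IsIntegral w.integer]
    (φF : (W.baseChange (v.adicCompletion K)).toAffine.Point →+ (AinfTop.curveFO (v.adicCompletion K) (Wm.map ψm)).toAffine.Point)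
    (hφF : ∀ P, φ (toGeomPoints (W.baseChange (v.adicCompletion K)) P) = toGeomPoints (AinfTop.curveFO (v.adicCompletion K) (Wm.map ψm)) (φF P))
    -- the rescaling of `log_ω` under `φ_F`
    (w' : Valuation (v.adicCompletion K) ℝ≥0) [(W.baseChange (v.adicCompletion K)).IsIntegral w'.integer] :
    ∀ (u : v.adicCompletion K) (_ : ∀ P, padicLogPointFiniteExt w (AinfTop.curveFO (v.adicCompletion K) (Wm.map ψm)) p (φF P) =
      u * padicLogPointFiniteExt w' (W.baseChange (v.adicCompletion K)) p P),
    letI := LocalField.padicAlgebra (v.adicCompletion K) p hpv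
    ∃ c : v.adicCompletion K,
      ∀ (η : contOneCocycles (restrictedTateRep W (v.adicCompletion K) p).toTopRep) (P : (W.baseChange (v.adicCompletion K)).toAffine.Point),
        ((tatePairingPoint W (v.adicCompletion K) p e hμ hadd₁ hadd₂ hgal hcompat (oneCocycleClass _ η) P : ℤ_[p]) : ℚ_[p]) =
          Algebra.trace ℚ_[p] (v.adicCompletion K)
            (c * expStarCoord W hpv d η * padicLogPointFiniteExt w' (W.baseChange (v.adicCompletion K)) p P) := by
  intro u hlogφ
  letI := LocalField.padicAlgebra (v.adicCompletion K) p hpv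
  have h1 := exists_const_tatePairingPoint_eq_trace_mul_padicLog_transportHom v hpv Dv Wm ψm hψm hp2 hΔ hA W φ hφ Tφ hTφ e hμ hadd₁ hadd₂ hgal
    hcompat hp5 E₀ hWE hΔ₀ hA₀ (N := N) hN hN1' ψ hψ hψlog
  have h2 := h1 heL healt henondeg
  obtain ⟨c₀, hc₀⟩ := h2 hinj hde d w φF hφF
  clear h1 h2
  refine ⟨c₀ * u, fun η P => ?_⟩
  rw [hc₀ η P, hlogφ P]
  congr 1
  ring

end Summit.BirchSwinnertonDyer.BirchSwinnertonDyer.Theorems.TransportedReciprocityTransportHomAllPoints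

end
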